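import Summits.CriticalPhenomena.PercolationContinuityZ3.Theorems.PercNearOneGluingNoHeavyLowerTailPatternLightestStarGlue
import Literature.Probability.Percolation.SetPassengerExchange
import HarnessLib

/-!
# `NoHeavyLowerTail` (stmt-CriticalPhenomena-4575) — exchange through a GLUED SET: the hypothesis of self-gluing
# dominance for an arbitrary (not relay-neighboured) observer

Support file (prover `prim-hp-8`, PL programme / coin reduction; `--supports stmt-CriticalPhenomena-4575`).
No definitions, no named facts, no sorries.

Setting of `PatternLightestStar.selfGluingLoss_ge`: weights `v`, relays `A`, level `j`, an observer `o`, a vertex `c ≠ o` with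
`v s(o,c) = 0`, `H` = the weights with the pairs at `o` switched off (`fun e => if o ∉ e then v e else 0`), `R_y = {|π(y)| ≤ j}`,
`D = {o ↮ c}`, `E = {o ↔ x}`.  The star proof (`selfGluingLoss_ge_star`) needed every positive-weight neighbour of `o` to be a
relay dominated by `c` in `H`.  Here the observer is ARBITRARY:

* `reachable_from_obs_iff'` — `reachable_from_obs_iff` ignoring the loop at `o`.
* `gluedSet_exchange` — if the weights at `o` are deterministic (`0` or `1` off the loop), `v s(o,c) = 0`, and
  `μ_H(R_x) ≤ μ_H(R_c)`, then `μ_v(D ∩ (R_o ∩ R_cᶜ ∩ E)) ≤ μ_v(D ∩ (R_c ∩ R_oᶜ ∩ E))`: "given `o ↮ c` and `x` riding with `o`,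
  '`o` lonely, `c` crowded' is no likelier than '`c` lonely, `o` crowded'" — for `o` glued to ANY set of vertices (free or
  relays), the comparison of `x` and `c` being taken in the UNGLUED graph `H`.  Proof: unglue (transport to `H` on the
  full-measure event fixing the edges at `o`) and apply `setPassengerLonelyTransfer` (one BHK exchange in `H`).
This is the exchange ingredient of the general self-gluing dominance (TOP'', file `…SelfGluingDominance.lean`) and of the
coin reduction of the pattern-lightest bound (memo PROOF-COIN-REDUCTION.md on the item).
-/

noncomputable section

namespace Summit.CriticalPhenomena.PercolationContinuityZ3.Theorems

namespace CoinReduction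

open MeasureTheory Set Literature.Probability.LatticeModels Literature.Probability.Percolation
open scoped Classical

variable {n : ℕ}

/-- On a configuration whose open non-loop edges at `o` are exactly the edges to `U` (`o ∉ U`), reachability from `o` is
reachability from some `y ∈ U` avoiding `o`.  (`PatternLightestStar.reachable_from_obs_iff` without any condition on the loop
`s(o,o)`.) [folklore] -/
theorem reachable_from_obs_iff' (ω : BondConfig (Fin n)) {o : Fin n} (U : Finset (Fin n)) (hoU : o ∉ U)
    (hG : ∀ y : Fin n, y ≠ o → (s(o, y) ∈ ω ↔ y ∈ U)) (z : Fin n) (hz : z ≠ o) :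
    (openGraph ω).Reachable o z ↔ ∃ y ∈ U, (openGraph (ω ∩ {e | o ∉ e})).Reachable y z := by
  constructor
  · intro h
    obtain ⟨wk⟩ := h
    set q := wk.bypass with hq
    have hpath : q.IsPath := wk.bypass_isPath
    cases hq' : q with
    | nil => exact absurd rfl hz
    | cons hadj q' =>
      rename_i y
      rw [hq'] at hpath
      rw [SimpleGraph.Walk.cons_isPath_iff] at hpath
      rw [openGraph, SimpleGraph.fromEdgeSet_adj] at hadj
      refine ⟨y, (hG y (Ne.symm hadj.2)).1 hadj.1, ?_⟩
      exact CutObserver.reachable_avoiding_of_walk q' hpath.2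
  · rintro ⟨y, hyU, hyz⟩
    have hoy : o ≠ y := fun h => hoU (h ▸ hyU)
    have hadj : (openGraph ω).Adj o y := by
      rw [openGraph, SimpleGraph.fromEdgeSet_adj]; exact ⟨(hG y (Ne.symm hoy)).2 hyU, hoy⟩
    exact hadj.reachable.trans (CutObserver.reachable_mono inter_subset_left hyz)

/-- **Exchange through a glued set.**  Weights `v` deterministic at `o` (`v s(o,y) ∈ {0,1}` for `y ≠ o`), `c ≠ o` with
`v s(o,c) = 0`, `x ≠ o`, and `μ_H(R_x) ≤ μ_H(R_c)` in the graph `H` with the pairs at `o` switched off.  Then, with `D = {o ↮ c}`,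
`E = {o ↔ x}`:  `μ_v(D ∩ (R_o ∩ R_cᶜ ∩ E)) ≤ μ_v(D ∩ (R_c ∩ R_oᶜ ∩ E))`.  (Unglue `o` and apply `setPassengerLonelyTransfer` in
`H` with the pair `(x, c)` and the set `U` of vertices glued to `o`.) [cite: VandenbergHaggstromKahn2005, Thm. 1.5 (p. 7) —
via `setPassengerLonelyTransfer`] -/
theorem gluedSet_exchange (v : Sym2 (Fin n) → unitInterval) (A : Finset (Fin n)) (j : ℕ) {o c x : Fin n}
    (hco : c ≠ o) (hxo : x ≠ o) (hvc : v s(o, c) = 0)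
    (hdet : ∀ y : Fin n, y ≠ o → v s(o, y) = 0 ∨ v s(o, y) = 1)
    (hle : (prodBernoulli fun e : Sym2 (Fin n) => if e ∈ {e : Sym2 (Fin n) | o ∉ e} then v e else 0).real
        {ω : BondConfig (Fin n) | (A.filter fun z => ω ∈ openConn x z).card ≤ j} ≤
      (prodBernoulli fun e : Sym2 (Fin n) => if e ∈ {e : Sym2 (Fin n) | o ∉ e} then v e else 0).real
        {ω : BondConfig (Fin n) | (A.filter fun z => ω ∈ openConn c z).card ≤ j}) :
    (prodBernoulli v).real ((openConn o c)ᶜ ∩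
        ({ω : BondConfig (Fin n) | (A.filter fun z => ω ∈ openConn o z).card ≤ j} ∩
          {ω : BondConfig (Fin n) | (A.filter fun z => ω ∈ openConn c z).card ≤ j}ᶜ ∩ openConn o x)) ≤
      (prodBernoulli v).real ((openConn o c)ᶜ ∩
        ({ω : BondConfig (Fin n) | (A.filter fun z => ω ∈ openConn c z).card ≤ j} ∩
          {ω : BondConfig (Fin n) | (A.filter fun z => ω ∈ openConn o z).card ≤ j}ᶜ ∩ openConn o x)) := by
  set μ := prodBernoulli v with hμ
  set u : Sym2 (Fin n) → unitInterval := fun e => if e ∈ {e : Sym2 (Fin n) | o ∉ e} then v e else 0 with hu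
  set Ro : Set (BondConfig (Fin n)) := {ω | (A.filter fun z => ω ∈ openConn o z).card ≤ j} with hRo
  set Rc : Set (BondConfig (Fin n)) := {ω | (A.filter fun z => ω ∈ openConn c z).card ≤ j} with hRc
  set Rx : Set (BondConfig (Fin n)) := {ω | (A.filter fun z => ω ∈ openConn x z).card ≤ j} with hRx
  set D : Set (BondConfig (Fin n)) := (openConn o c)ᶜ with hD
  set E : Set (BondConfig (Fin n)) := openConn o x with hE
  have hmeas : ∀ S : Set (BondConfig (Fin n)), MeasurableSet S := fun S => (Set.toFinite S).measurableSet
  -- the trivial case x = c: the left event is empty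
  by_cases hxc : x = c
  · subst hxc
    have hempty : D ∩ (Ro ∩ Rcᶜ ∩ E) = ∅ := by
      ext ω
      constructor
      · rintro ⟨hDω, _, hEω⟩
        exact absurd hEω hDω
      · intro h
        exact absurd h (Set.notMem_empty ω)
    rw [hempty, measureReal_empty]
    exact measureReal_nonneg
  -- the set glued to o and the full-measure event fixing the edges at o
  set U : Finset (Fin n) := Finset.univ.filter fun y => y ≠ o ∧ v s(o, y) = 1 with hUdef
  have hoU : o ∉ U := by
    intro h; exact (Finset.mem_filter.1 h).2.1 rfl
  have hcU : c ∉ U := by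
    intro h
    have := (Finset.mem_filter.1 h).2.2
    rw [hvc] at this
    exact zero_ne_one this
  set G : Set (BondConfig (Fin n)) := {ω | ∀ y : Fin n, y ≠ o → (s(o, y) ∈ ω ↔ y ∈ U)} with hGdef
  have hGae : ∀ᵐ ω ∂μ, ω ∈ G := by
    have h : ∀ y : Fin n, ∀ᵐ ω ∂μ, y ≠ o → (s(o, y) ∈ ω ↔ y ∈ U) := by
      intro y
      by_cases hyo : y = o
      · exact Filter.Eventually.of_forall fun ω h => absurd hyo h
      rcases hdet y hyo with h0 | h1
      · have hyU : y ∉ U := by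
          intro h; have := (Finset.mem_filter.1 h).2.2; rw [h0] at this; exact zero_ne_one this
        filter_upwards [prodBernoulli_ae_notMem v h0] with ω hω
        exact fun _ => iff_of_false hω hyU
      · have hyU : y ∈ U := Finset.mem_filter.2 ⟨Finset.mem_univ _, hyo, h1⟩
        filter_upwards [prodBernoulli_ae_mem_of_eq_one v h1] with ω hω
        exact fun _ => iff_of_true hω hyU
    filter_upwards [ae_all_iff.2 h] with ω hω
    exact hω
  -- the H-events
  set P : Set (BondConfig (Fin n)) :=
    (⋃ y ∈ U, (openConn x y : Set (BondConfig (Fin n)))) ∩ ⋂ y ∈ U, (openConn c y : Set (BondConfig (Fin n)))ᶜ with hP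
  set Em : Set (BondConfig (Fin n)) := (openConn x c)ᶜ ∩ (Rx ∩ Rcᶜ ∩ P) with hEm
  set Ep : Set (BondConfig (Fin n)) := (openConn x c)ᶜ ∩ (Rc ∩ Rxᶜ ∩ P) with hEp
  have hH : (prodBernoulli u).real Em ≤ (prodBernoulli u).real Ep :=
    setPassengerLonelyTransfer u A j hxc U hle
  -- facts on G
  have hF1 : ∀ ω ∈ G, ∀ z : Fin n, z ≠ o →
      ((openGraph ω).Reachable o z ↔ ∃ y ∈ U, (openGraph (ω ∩ {e | o ∉ e})).Reachable y z) :=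
    fun ω hωG z hz => reachable_from_obs_iff' ω U hoU hωG z hz
  have hF2 : ∀ ω : BondConfig (Fin n), ∀ a b : Fin n, ¬ (openGraph ω).Reachable a o →
      ((openGraph ω).Reachable a b ↔ (openGraph (ω ∩ {e | o ∉ e})).Reachable a b) :=
    fun ω a b hao => ⟨fun h => CutObserver.reachable_avoiding_of_not_reachable hao h,
      fun h => CutObserver.reachable_mono inter_subset_left h⟩
  -- Claim 1: the left event is contained (on G) in the preimage of Em
  have hC1 : D ∩ (Ro ∩ Rcᶜ ∩ E) ∩ G ⊆ {ω | ω ∩ {e | o ∉ e} ∈ Em} := by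
    rintro ω ⟨⟨hDω, ⟨hRoω, hRcω⟩, hEω⟩, hωG⟩
    have hox : (openGraph ω).Reachable o x := hEω
    have hnoc : ¬ (openGraph ω).Reachable o c := hDω
    have hco' : ¬ (openGraph ω).Reachable c o := fun h => hnoc h.symm
    simp only [mem_setOf_eq, hEm, mem_inter_iff, mem_compl_iff]
    refine ⟨?_, ⟨?_, ?_⟩, ?_⟩
    · -- x ↮ c in the restricted configuration
      intro h
      have h' : (openGraph (ω ∩ {e | o ∉ e})).Reachable x c := h
      exact hnoc (hox.trans (CutObserver.reachable_mono inter_subset_left h'))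
    · -- R_x in the restricted configuration
      simp only [hRx, mem_setOf_eq]
      refine le_trans (Finset.card_le_card ?_) hRoω
      intro z hz
      simp only [Finset.mem_filter] at hz ⊢
      refine ⟨hz.1, ?_⟩
      have h' : (openGraph (ω ∩ {e | o ∉ e})).Reachable x z := hz.2
      exact (hox.trans (CutObserver.reachable_mono inter_subset_left h') : (openGraph ω).Reachable o z)
    · -- not R_c in the restricted configuration
      simp only [hRc, mem_setOf_eq] at hRcω ⊢
      intro h
      apply hRcω
      refine le_trans (le_of_eq ?_) h
      apply congrArg Finset.card
      apply Finset.filter_congr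
      intro z _
      exact hF2 ω c z hco'
    · -- P
      simp only [hP, mem_inter_iff, mem_iUnion, mem_iInter, mem_compl_iff, exists_prop]
      constructor
      · obtain ⟨y, hyU, hyx⟩ := (hF1 ω hωG x hxo).1 hox
        exact ⟨y, hyU, (hyx.symm : (openGraph (ω ∩ {e | o ∉ e})).Reachable x y)⟩
      · intro y hyU h
        have h' : (openGraph (ω ∩ {e | o ∉ e})).Reachable c y := h
        exact hnoc ((hF1 ω hωG c hco).2 ⟨y, hyU, h'.symm⟩)
  -- Claim 2: the preimage of Ep is contained (on G) in the right event
  have hC2 : {ω | ω ∩ {e | o ∉ e} ∈ Ep} ∩ G ⊆ D ∩ (Rc ∩ Roᶜ ∩ E) := by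
    rintro ω ⟨hω, hωG⟩
    simp only [mem_setOf_eq, hEp, mem_inter_iff, mem_compl_iff] at hω
    obtain ⟨_, ⟨hRc', hRx'⟩, hP'⟩ := hω
    simp only [hP, mem_inter_iff, mem_iUnion, mem_iInter, mem_compl_iff, exists_prop] at hP'
    obtain ⟨⟨y, hyU, hxy⟩, hcy⟩ := hP'
    have hox : (openGraph ω).Reachable o x :=
      (hF1 ω hωG x hxo).2 ⟨y, hyU, (hxy.symm : (openGraph (ω ∩ {e | o ∉ e})).Reachable y x)⟩
    have hnoc : ¬ (openGraph ω).Reachable o c := by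
      intro h
      obtain ⟨y', hy'U, hy'c⟩ := (hF1 ω hωG c hco).1 h
      exact hcy y' hy'U (hy'c.symm : (openGraph (ω ∩ {e | o ∉ e})).Reachable c y')
    have hco' : ¬ (openGraph ω).Reachable c o := fun h => hnoc h.symm
    refine ⟨hnoc, ⟨?_, ?_⟩, hox⟩
    · simp only [hRc, mem_setOf_eq] at hRc' ⊢
      refine le_trans (le_of_eq ?_) hRc'
      apply congrArg Finset.card
      apply Finset.filter_congr
      intro z _
      exact hF2 ω c z hco'
    · simp only [hRo, hRx, mem_setOf_eq] at hRx' ⊢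
      intro h
      apply hRx'
      refine le_trans (Finset.card_le_card ?_) h
      intro z hz
      simp only [Finset.mem_filter] at hz ⊢
      refine ⟨hz.1, ?_⟩
      have h' : (openGraph (ω ∩ {e | o ∉ e})).Reachable x z := hz.2
      exact (hox.trans (CutObserver.reachable_mono inter_subset_left h') : (openGraph ω).Reachable o z)
  -- measure bookkeeping
  have hm1 : μ.real (D ∩ (Ro ∩ Rcᶜ ∩ E)) = μ.real (D ∩ (Ro ∩ Rcᶜ ∩ E) ∩ G) := by
    refine measureReal_congr (hGae.mono fun ω hω => ?_)
    exact propext ⟨fun h => ⟨h, hω⟩, fun h => h.1⟩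
  have hm2 : μ.real {ω : BondConfig (Fin n) | ω ∩ {e | o ∉ e} ∈ Ep} =
      μ.real ({ω : BondConfig (Fin n) | ω ∩ {e | o ∉ e} ∈ Ep} ∩ G) := by
    refine measureReal_congr (hGae.mono fun ω hω => ?_)
    exact propext ⟨fun h => ⟨h, hω⟩, fun h => h.1⟩
  calc μ.real (D ∩ (Ro ∩ Rcᶜ ∩ E)) = μ.real (D ∩ (Ro ∩ Rcᶜ ∩ E) ∩ G) := hm1
    _ ≤ μ.real {ω : BondConfig (Fin n) | ω ∩ {e | o ∉ e} ∈ Em} := measureReal_mono hC1 (measure_ne_top _ _)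
    _ = (prodBernoulli u).real Em := CutObserver.measureReal_preimage_avoid v o Em
    _ ≤ (prodBernoulli u).real Ep := hH
    _ = μ.real {ω : BondConfig (Fin n) | ω ∩ {e | o ∉ e} ∈ Ep} :=
        (CutObserver.measureReal_preimage_avoid v o Ep).symm
    _ = μ.real ({ω : BondConfig (Fin n) | ω ∩ {e | o ∉ e} ∈ Ep} ∩ G) := hm2
    _ ≤ μ.real (D ∩ (Rc ∩ Roᶜ ∩ E)) := measureReal_mono hC2 (measure_ne_top _ _)

end CoinReduction

end Summit.CriticalPhenomena.PercolationContinuityZ3.Theorems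

end
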